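import Summits.BirchSwinnertonDyer.Rank1Residual.GaloisImage.KolyvaginLevelOneUnitCaseOfKatoClasses
import Summits.BirchSwinnertonDyer.Rank1Residual.GaloisImage.KatoKuriharaDictionaryThree
import HarnessLib

/-!
# DICT3 @ 3 at LEVEL ONE on `E[3]` (typed PORT predicate, the E[3]-literal twin of n1011-p09's
# `KatoKuriharaDictionaryThreeAt`) and its consumer: `DICT3₁ ∧ 3 ∤ c₃ ∧ E(ℚ₃)[3] = 0 ∧ [0]⁺ ∈ 𝔽₃ˣ
# ⟹ BSD(E,3)` on surj(3), `r_an = 0`, `3 ∤ #Ш_an` rows — the EXOTIC unit case end to end, NO tower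
# (cell `b2b-bsdres`, team n1011, row T-a5x; seat p13; predicate = route R1-21's currency at `m = 1`)

HONEST FRAMING (cell `b2b-bsdres`, run/shared/lean/b2b/bsd-rank1-residual/, verbatim in every
file): the goal of the cell is to DELETE the COMBINATION-SHAPED residual classes of the
Birch–Swinnerton-Dyer formula for ALL analytic-rank `≤ 1` elliptic curves over `ℚ` — "full BSD
formula for every rank `≤ 1` curve in class `C`" assembled STRICTLY from published theorems — so
that the rank-`≤ 1` remainder becomes exactly the CONSTRUCTION-SHAPED classes, which are TYPED
(missing-input `Prop`s), NOT attempted. This is not "finishing BSD". Team n1011 (N10/N11, the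
additive block `X4 ∧ p = 3`): research route; no claim beyond the stated classes; the label X4 and
the mark of RESIDUAL-MAP §I N11 are UNCHANGED by this file; nothing is booked.  ONE definition — a
typed MISSING-INPUT predicate (PORT of [K22] Thm. 3.13 to the additive prime `3`, FLAG
`K22-Thm3.13-PORT@3`, exactly as n1011-p09's level-spelling parent `KatoKuriharaDictionaryThreeAt`
(p262039): NOT in print at `3`, to be ASSUMED by its consumer, never `_holds`) — and two theorems; no
named fact is minted.  The end theorem is CONDITIONAL on that predicate, on the three named facts
`hS24`, `hS24₂`, `hGZK`, on the Poitou–Tate family and on `hEP`, all explicit.  EXOTIC rows are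
reduced to (F1)(F2)(F3)(PT)(EP)(Lp) + the certificate; none is closed.

## What and why

p266233 `bsdp_three_of_katoClasses_levelOne` takes the four dictionary clauses at `m = 1`, `d = ∅` on
`E[3]` as separate hypotheses.  n1011-p09's typed dictionary `KatoKuriharaDictionaryThreeAt W k t D v₃`
(route R1-21) packages exactly these clauses — but in the LEVEL spelling (`E[3^k·3]`,
`propagatedSelmerStructure W 3 k`, `ℤ/3^{k+1}`), which at `k = 0` is only propositionally equal to the
`E[3]`-literal world where the `3`-Selmer group, p11's R1-16 reading and the unit case live.  This file
types the `m = 1` content ON `E[3]` (same antecedents, same clauses, same cite tags and flag) and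
closes the row's chain:

* `KatoKuriharaDictionaryThreeOneAt W t D v₃` — the predicate (definition; a hypothesis schema).
* `kuriharaNumber_eq_ratModP_of_eq_one` — `δ̃_1 = [0]⁺` under any `NeZero` instance on the level
  (rewriting form of the tree's `kuriharaNumber_one`).
* **`bsdp_three_of_dictionaryOne`** — for `W/ℚ` globally minimal, additive at `3` with `3 ∤ c₃`,
  `ρ̄_{E,3}` onto, `E(ℚ₃)[3] = 0` (`t = 0`), `r_an = 0`, `3 ∤ #Ш_an`, a modular parametrisation `P`
  with `3 ∤ c_P` and the `3`-adic unit period transfer, and **`[0]⁺_{P.f} = L(f,1)/Ω⁺_f` a `3`-adic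
  unit** (`ratModP 3 (ratPlusSymbol P.f 0) ≠ 0`): `KatoKuriharaDictionaryThreeOneAt W 0 D v₃` +
  the binders of `KolyvaginLevelOneUnitCase` ⟹ **`BSD(E, 3)`**.  Proof: the predicate yields `κ`, `Λ`,
  `κ′` with (I4), the Kummer kernel clause and `Λ(loc κ_∅) = u·3⁰·δ̃_1 = u·[0]⁺ ≠ 0`; then p266233.
* `exists_kolyvaginDatum_bsdp_three_of_dictionaryOne` — `τ`, `η`, `D`, `v₃` discharged existentially
  (p260356, p04's T-HCC, the place above `3` from `PropagatedStructureCoreRank`).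

Binders of the end theorem (nothing hidden): `hS24`, `hS24₂`, `hGZK`; `[Finite E[3]]`; `Addv W 3`,
`3 ∤ c₃`, surj(3), `#E(ℚ₃)[3] = 1`, `r_an = 0`, `#Ш_an = q` with `ord₃ q = 0`; the `τ`-datum; the
Poitou–Tate family ×4; `hEP`; an admissible `S`; the Kolyvagin datum `D`, `η`, `hP`, `hT`, `hD` on
`E[3]`; `v₃ ∣ 3`; **the dictionary `KatoKuriharaDictionaryThreeOneAt W 0 D v₃`** (PORT hypothesis —
Kato's Euler/Kolyvagin system and the explicit reciprocity law at the additive prime `3`, NOT in the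
tree); `P`, `3 ∤ c_P`, the period transfer; the unit `[0]⁺`.  NO tower, NO (im), NO Tamagawa / Manin
beyond the stated binders.  Nothing booked; no mark / label changed.

References: C.-H. Kim, AJM 148 (2026) = arXiv:2203.12159, Thm. 3.13, §3.3–§3.4.1
[Kim2022StructureSelmer]; K. Kato, Astérisque 295 (2004) Thm. 12.5 [Kato2004Asterisque]; B. Mazur,
K. Rubin, Mem. AMS 799 (2004) Thm. 3.2.4, App. A [MazurRubin2004]; R. Sakamoto, JTNB 36 (2024)
Thm. 4.4 [Sakamoto2024]; M. Kurihara, Münster J. Math. 7 (2014) §1.1 [Kurihara2014].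
-/

noncomputable section

open scoped Classical NumberField ContRepresentation
open Field NumberField IsDedekindDomain
open WeierstrassCurve Literature.NumberTheory.EllipticCurves Literature.NumberTheory.EllipticCurves.ModularForms
  Literature.NumberTheory.EllipticCurves.Rank1Residual
  Literature.NumberTheory.GaloisRepresentations
  Literature.NumberTheory.GaloisRepresentations.DiscreteGaloisModule Literature.NumberTheory.GaloisCohomology
open Literature.NumberTheory.DiophantineGeometry.Dioph (ratModP)

namespace Summit.BirchSwinnertonDyer.Rank1Residual.GaloisImage

/-- **DICT3 @ 3 at LEVEL ONE, on `E[3]` itself** (PORT of [K22] Thm. 3.13 at `m = 1` to the additive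
prime `3`; FLAG `K22-Thm3.13-PORT@3`; the `k = 0` content of `KatoKuriharaDictionaryThreeAt` written on
`T = E[3]` / `𝓕̄_can = propagatedSelmerStructureOne W 3` / `ℤ/3` instead of the level spelling
`E[3^0·3]` / `propagatedSelmerStructure W 3 0` / `ℤ/3^1`; a missing-input predicate, to be ASSUMED by
its consumer, never `_holds`).  For `W/ℚ` globally minimal with ADDITIVE reduction at `3`, `3 ∤ c₃`,
`ρ̄_{E,3}` onto, the `3`-torsion exponent `t` (`#E(ℚ₃)[3] = 3^t`), a Kolyvagin datum `D` on `E[3]`,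
a place `v₃ ∣ 3`: for every modular parametrisation datum `P` with `3 ∤ c_P` and the period transfer
`Ω(W) = u·Ω⁺_{P.f}`, `|u|₃ = 1`, there exist Kato's family `κ` (`κ_d ∈ H¹_{𝓕̄_can(d)}(ℚ, E[3])`), a
Kolyvagin system `κ′ ∈ KS₁(E[3], 𝓕̄_can, 𝒫)` unitriangularly congruent to it, and the functional
`Λ = ι∘3^t·exp*_ω : H¹(ℚ_{v₃}, E[3]) → ℤ/3` (onto on `𝓕̄_can(v₃)`, kernel the Kummer part) with
`Λ(loc_{v₃} κ_d) = u_d · 3^t · δ̃_{n(d)}` (mod `3`) at every level `d ⊆ 𝒫`.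
LEDGER RIDERS (route planner r1 GEN 14, 2026-08-21): (R-a) ONE PORT, TWO SPELLINGS — this predicate
and `KatoKuriharaDictionaryThreeAt W t 0 …` are the SAME named port DICT3 (one debt line, not two);
(R-b) with `hP` pinning `D.primes` at Kolyvagin level `1` the predicate is the printed one iff `t = 0`
(the consumer below takes `#E(ℚ₃)[3] = 1`, i.e. exactly that case; at `t ≥ 1` the printed statement
needs primes of level `≥ 1 + t`, ROUTE-1 §24.2 (b)); (R-d) PROVENANCE of `κ` on EXOTIC rows (flag
`EXOTIC-Kato-integrality@3`, doc-only): on rows WITHOUT the `3`-adic tower Kato's Thm. 12.5 (4) does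
not apply ((12.5.2) = `ImageContainsSL2` fails); the integral class `κ` is Kato's `z_γ` via
Thm. 12.4 (3) + Thm. 12.6 + 13.12–13.14 (`E[3]` irreducible), not 12.5 (4); tame-level integrality
on rows without the tower: not located in print (R1-42 / R1-42′, ROUTE-1 §26; the flag may split by
r1's computable row filter `𝒰₃` — provenance bookkeeping only, no binder of this predicate changes).
[cite: Kim2022StructureSelmer, Thm. 3.13 and §3.3–§3.4.1 (arXiv pp. 17–18)]
[cite: Kato2004Asterisque, Thm. 12.5 (1), Thm. 12.4 (3), Thm. 12.6, 13.12–13.14]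
[cite: MazurRubin2004, Thm. 3.2.4 and App. A (33)] -/
def KatoKuriharaDictionaryThreeOneAt (W : WeierstrassCurve ℚ) [W.IsElliptic] [W.IsGloballyMinimal]
    (t : ℕ) (D : KolyvaginDatum (W.torsionGaloisModule ((3 : ℕ) : ℤ)))
    (v₃ : HeightOneSpectrum (𝓞 ℚ)) : Prop :=
  haveI : Fact (Nat.Prime 3) := ⟨Nat.prime_three⟩
  Addv W 3 → ¬ 3 ∣ (W.baseChange ℚ_[3]).localTamagawaNumber ℤ_[3] →
  W.HasSurjectiveModNGaloisRep ((3 : ℕ) : ℤ) →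
  Nat.card {Q : (W.baseChange ℚ_[3]).toAffine.Point // (3 : ℕ) • Q = 0} = 3 ^ t →
  ((3 : ℕ) : 𝓞 ℚ) ∈ v₃.asIdeal →
  ∀ {N : ℕ} [NeZero N] (P : ModularParametrizationData W N),
    ¬ ((3 : ℕ) : ℤ) ∣ P.maninConstant →
    (∃ u : ℚ, ‖(u : ℚ_[3])‖ = 1 ∧ W.realPeriodRat = u * plusPeriod P.f) →
    ∃ (κ : Finset (HeightOneSpectrum (𝓞 ℚ)) → galoisCohomology (W.torsionGaloisModule ((3 : ℕ) : ℤ)) 1)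
      (Λ : galoisCohomology ((W.torsionGaloisModule ((3 : ℕ) : ℤ)).toLocal (Sum.inr v₃)) 1 →+ ZMod 3),
      -- (0) Kato's derivative classes live in the level-`d` propagated Selmer groups
      (∀ d, D.IsLevel d → κ d ∈ (D.atLevel (propagatedSelmerStructureOne W 3) d).selmerGroup) ∧
      -- (I4) a genuine Kolyvagin system, unitriangularly congruent to `κ`
      (∃ κ' : D.kolyvaginSystems (propagatedSelmerStructureOne W 3), ∀ d, D.IsLevel d →
          κ'.1 d - κ d ∈ AddSubgroup.closure {x | ∃ c, c ⊂ d ∧ x = κ c}) ∧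
      -- (Λ) onto `ℤ/3` on `𝓕̄_can(v₃)`, kernel = the Kummer part
      (∀ r : ZMod 3, ∃ x ∈ propagatedSelmerStructureOne W 3 (Sum.inr v₃), Λ x = r) ∧
      (∀ x ∈ propagatedSelmerStructureOne W 3 (Sum.inr v₃),
          Λ x = 0 ↔ x ∈ W.kummerSelmerStructure ((3 : ℕ) : ℤ) (Sum.inr v₃)) ∧
      -- (DICT3) at every level
      ∀ (d : Finset (HeightOneSpectrum (𝓞 ℚ))), D.IsLevel d →
        ∃ (u : (ZMod 3)ˣ) (ψ : (ℓ : ℕ) → (ZMod ℓ)ˣ →* Multiplicative (ZMod 3)),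
          (∀ q ∈ d, Function.Surjective (ψ (Ideal.absNorm q.asIdeal))) ∧
          haveI : NeZero (∏ q ∈ d, Ideal.absNorm q.asIdeal) :=
            ⟨Finset.prod_ne_zero_iff.2 fun q _ h => q.ne_bot (Ideal.absNorm_eq_zero_iff.1 h)⟩
          Λ (galoisCohomology.localization _ (Sum.inr v₃) 1 (κ d)) =
            (u : ZMod 3) * (3 : ZMod 3) ^ t *
              kuriharaNumber P.f 3 (∏ q ∈ d, Ideal.absNorm q.asIdeal) ψ

/-- `δ̃_1 = [0]⁺` whatever the instance of `NeZero` on the level and whatever `ψ`: a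
`NeZero`-polymorphic restatement of `kuriharaNumber_one` for rewriting under the binder. [folklore] -/
theorem kuriharaNumber_eq_ratModP_of_eq_one {N : ℕ} (f : CuspForm (CongruenceSubgroup.Gamma0 N) 2)
    (m n : ℕ) (inst : NeZero n) (hn : n = 1)
    (ψ : (ℓ : ℕ) → (ZMod ℓ)ˣ →* Multiplicative (ZMod m)) :
    @kuriharaNumber N f m n inst ψ = ratModP m (ratPlusSymbol f 0) := by
  subst hn
  convert kuriharaNumber_one f m ψ

variable (W : WeierstrassCurve ℚ) [W.IsElliptic] [W.IsGloballyMinimal]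

/-- **The EXOTIC unit case from DICT3 at level one** (`[0]⁺ = L(f,1)/Ω⁺_f` a `3`-adic unit and
`E(ℚ₃)[3] = 0`): `BSD(E, 3)` on additive `3 ∤ c₃`, surj(3), `r_an = 0`, `3 ∤ #Ш_an` rows, CONDITIONAL
on the dictionary predicate `KatoKuriharaDictionaryThreeOneAt W 0 D v₃` (PORT, a hypothesis), the
three named facts, the Poitou–Tate family, `hEP`; via p266233 `bsdp_three_of_katoClasses_levelOne`.
EXOTIC rows are reduced to (F1)(F2)(F3)(PT)(EP)(Lp) + the certificate; none is closed; NO tower.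
[cite: Kim2022StructureSelmer, Thm. 3.13] [cite: Sakamoto2024, Thm. 4.4 (p. 926)] -/
theorem bsdp_three_of_dictionaryOne
    (hS24 : Sakamoto2024.kolyvaginSystems_freeRankOne_zmod_three_pow)
    (hS24₂ : Sakamoto2024.kolyvaginSystems_idealOfBasis_eq_fittingIdeal_zmod_three_pow)
    (hGZK : rank_eq_analyticRank_of_analyticRank_le_one)
    [Finite (geomTorsion W ((3 : ℕ) : ℤ))]
    (hX : Addv W 3) (hc3 : ¬ 3 ∣ (W.baseChange ℚ_[3]).localTamagawaNumber ℤ_[3])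
    (h3 : W.HasSurjectiveModNGaloisRep ((3 : ℕ) : ℤ)) (hr : W.analyticRank = 0)
    (ht : Nat.card {Q : (W.baseChange ℚ_[3]).toAffine.Point // (3 : ℕ) • Q = 0} = 1)
    {q : ℚ} (hq : shaAn W = (q : ℂ)) (hv : padicValRat 3 q = 0)
    (τ : absoluteGaloisGroup ℚ) (hτμ : τ ∈ rootsOfUnityFixer ℚ 3)
    (hτq : Nonempty (cokerSubOne (W.torsionGaloisModule ((3 : ℕ) : ℤ)) τ ≃+ ZMod 3))
    (inv : LocalInvariants ℚ 3) (hperf : inv.IsPerfect) (hsum : inv.SumLocalTermEqZero)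
    (hunro : inv.UnramifiedOrthogonal) (hcompl : inv.SelmerComplement)
    (hEP : ∀ v : HeightOneSpectrum (𝓞 ℚ), localEulerPoincareCharacteristic (v.adicCompletion ℚ))
    (S : Finset (Place ℚ)) (hS : ∀ w : InfinitePlace ℚ, (Sum.inl w : Place ℚ) ∈ S)
    (h3S : ∀ v : HeightOneSpectrum (𝓞 ℚ), ((3 : ℕ) : 𝓞 ℚ) ∈ v.asIdeal → (Sum.inr v : Place ℚ) ∈ S)
    (hbadS : ∀ v : HeightOneSpectrum (𝓞 ℚ), ¬ W.HasGoodReductionAt v → (Sum.inr v : Place ℚ) ∈ S)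
    (D : KolyvaginDatum (W.torsionGaloisModule ((3 : ℕ) : ℤ)))
    (η : (q : HeightOneSpectrum (𝓞 ℚ)) → (ZMod (Ideal.absNorm q.asIdeal))ˣ)
    (hP : D.primes = frobeniusClassPrimes (W.torsionGaloisModule ((3 : ℕ) : ℤ))
      {v | (Sum.inr v : Place ℚ) ∈ S} τ 3)
    (hT : D.transverse = cyclotomicTransverse (W.torsionGaloisModule ((3 : ℕ) : ℤ)))
    (hD : D.HasCanonicalComparison 3 η)
    (v₃ : HeightOneSpectrum (𝓞 ℚ)) (hv₃ : ((3 : ℕ) : 𝓞 ℚ) ∈ v₃.asIdeal)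
    (hDict : KatoKuriharaDictionaryThreeOneAt W 0 D v₃)
    {N : ℕ} [NeZero N] (P : ModularParametrizationData W N)
    (hManin : ¬ ((3 : ℕ) : ℤ) ∣ P.maninConstant)
    (hΩ : ∃ u : ℚ, ‖(u : ℚ_[3])‖ = 1 ∧ W.realPeriodRat = u * plusPeriod P.f)
    (hunit : ratModP 3 (ratPlusSymbol P.f 0) ≠ 0) :
    BSDp W 3 := by
  obtain ⟨κ₀, Λ, -, ⟨κ', hI4⟩, -, hΛker, hdict⟩ :=
    hDict hX hc3 h3 (by rw [ht, pow_zero]) hv₃ P hManin hΩ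
  obtain ⟨u, ψ, -, hval⟩ := hdict ∅ D.isLevel_empty
  rw [kuriharaNumber_eq_ratModP_of_eq_one P.f 3 _ _ Finset.prod_empty ψ] at hval
  exact bsdp_three_of_katoClasses_levelOne W hS24 hS24₂ hGZK h3 hr hq hv τ hτμ hτq inv hperf hsum hunro
    hcompl hEP S hS h3S hbadS D η hP hT hD v₃ κ₀ κ' hI4 Λ hΛker hval rfl hunit


/-- **The same with `τ`, `η`, the datum `D` and the place `v₃` discharged existentially** (p260356 for
`τ`, n1011-p04's T-HCC `FSComp.exists_eta_kolyvaginDatum_hasCanonicalComparison_frobeniusClassPrimes`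
for `η`, `D`; `v₃` = the place of `ℚ` above `3`): on an additive `3 ∤ c₃`, surj(3), `E(ℚ₃)[3] = 0`,
`r_an = 0`, `3 ∤ #Ш_an` row with a `3`-adic unit `[0]⁺`, THERE ARE `τ`, `η`, `D`, `v₃` such that
the level-one dictionary `KatoKuriharaDictionaryThreeOneAt W 0 D v₃` ALONE (with the named facts,
the PT family and `hEP`) implies `BSD(E, 3)`.  Nothing booked; EXOTIC rows reduced, none closed.
[cite: Kim2022StructureSelmer, Thm. 3.13] [cite: Sakamoto2024, Thm. 4.4 (p. 926)] -/
theorem exists_kolyvaginDatum_bsdp_three_of_dictionaryOne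
    (hS24 : Sakamoto2024.kolyvaginSystems_freeRankOne_zmod_three_pow)
    (hS24₂ : Sakamoto2024.kolyvaginSystems_idealOfBasis_eq_fittingIdeal_zmod_three_pow)
    (hGZK : rank_eq_analyticRank_of_analyticRank_le_one)
    [Finite (geomTorsion W ((3 : ℕ) : ℤ))]
    (hX : Addv W 3) (hc3 : ¬ 3 ∣ (W.baseChange ℚ_[3]).localTamagawaNumber ℤ_[3])
    (h3 : W.HasSurjectiveModNGaloisRep ((3 : ℕ) : ℤ)) (hr : W.analyticRank = 0)
    (ht : Nat.card {Q : (W.baseChange ℚ_[3]).toAffine.Point // (3 : ℕ) • Q = 0} = 1)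
    {q : ℚ} (hq : shaAn W = (q : ℂ)) (hv : padicValRat 3 q = 0)
    (inv : LocalInvariants ℚ 3) (hperf : inv.IsPerfect) (hsum : inv.SumLocalTermEqZero)
    (hunro : inv.UnramifiedOrthogonal) (hcompl : inv.SelmerComplement)
    (hEP : ∀ v : HeightOneSpectrum (𝓞 ℚ), localEulerPoincareCharacteristic (v.adicCompletion ℚ))
    (S : Finset (Place ℚ)) (hS : ∀ w : InfinitePlace ℚ, (Sum.inl w : Place ℚ) ∈ S)
    (h3S : ∀ v : HeightOneSpectrum (𝓞 ℚ), ((3 : ℕ) : 𝓞 ℚ) ∈ v.asIdeal → (Sum.inr v : Place ℚ) ∈ S)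
    (hbadS : ∀ v : HeightOneSpectrum (𝓞 ℚ), ¬ W.HasGoodReductionAt v → (Sum.inr v : Place ℚ) ∈ S)
    {N : ℕ} [NeZero N] (P : ModularParametrizationData W N)
    (hManin : ¬ ((3 : ℕ) : ℤ) ∣ P.maninConstant)
    (hΩ : ∃ u : ℚ, ‖(u : ℚ_[3])‖ = 1 ∧ W.realPeriodRat = u * plusPeriod P.f)
    (hunit : ratModP 3 (ratPlusSymbol P.f 0) ≠ 0) :
    ∃ (τ : absoluteGaloisGroup ℚ) (η : (q : HeightOneSpectrum (𝓞 ℚ)) → (ZMod (Ideal.absNorm q.asIdeal))ˣ)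
      (D : KolyvaginDatum (W.torsionGaloisModule ((3 : ℕ) : ℤ))) (v₃ : HeightOneSpectrum (𝓞 ℚ)),
      τ ∈ rootsOfUnityFixer ℚ 3 ∧
      Nonempty (cokerSubOne (W.torsionGaloisModule ((3 : ℕ) : ℤ)) τ ≃+ ZMod 3) ∧
      D.primes = frobeniusClassPrimes (W.torsionGaloisModule ((3 : ℕ) : ℤ))
        {v | (Sum.inr v : Place ℚ) ∈ S} τ 3 ∧
      D.transverse = cyclotomicTransverse (W.torsionGaloisModule ((3 : ℕ) : ℤ)) ∧
      D.HasCanonicalComparison 3 η ∧ ((3 : ℕ) : 𝓞 ℚ) ∈ v₃.asIdeal ∧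
      (KatoKuriharaDictionaryThreeOneAt W 0 D v₃ → BSDp W 3) := by
  obtain ⟨τ, hτ, hτq⟩ := exists_rootsOfUnityFixer_cokerSubOne_equiv_zmod_three_of_surj W h3
  have hτμ : τ ∈ rootsOfUnityFixer ℚ 3 := hτ 3 (by norm_num)
  obtain ⟨η, D, hP, hT, hD⟩ :=
    FSComp.exists_eta_kolyvaginDatum_hasCanonicalComparison_frobeniusClassPrimes
      (W.torsionGaloisModule ((3 : ℕ) : ℤ)) 3 {v | (Sum.inr v : Place ℚ) ∈ S} hτμ hτq
      (cyclotomicTransverse (W.torsionGaloisModule ((3 : ℕ) : ℤ)))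
  let v₃ : HeightOneSpectrum (𝓞 ℚ) := (Rat.HeightOneSpectrum.primesEquiv (R := 𝓞 ℚ)).symm ⟨3, Nat.prime_three⟩
  have hv₃ : ((3 : ℕ) : 𝓞 ℚ) ∈ v₃.asIdeal := three_mem_primesEquiv_symm_three
  exact ⟨τ, η, D, v₃, hτμ, hτq, hP, hT, hD, hv₃, fun hDict =>
    bsdp_three_of_dictionaryOne W hS24 hS24₂ hGZK hX hc3 h3 hr ht hq hv τ hτμ hτq inv hperf hsum hunro
      hcompl hEP S hS h3S hbadS D η hP hT hD v₃ hv₃ hDict P hManin hΩ hunit⟩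

end Summit.BirchSwinnertonDyer.Rank1Residual.GaloisImage

end
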